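import Literature.NumberTheory.Automorphic.GodementJacquetDualTerm
import Literature.NumberTheory.Automorphic.GodementJacquetGlobalConvergence
import Literature.NumberTheory.Automorphic.GLnAutomorphicUnfolding
import HarnessLib

/-!
# Assembly of the Godement–Jacquet analytic continuation for `n ≥ 2`, given the vanishing of the
# singular defect

Topic `NumberTheory/Automorphic`; namespace `Literature.NumberTheory.Automorphic`. An assembly step
of the discharge of `GodementJacquet1972_gjZeta_meromorphic` (Godement–Jacquet (1972), Thm. 13.8):

* `gjZeta_entire_continuation_of_eq_dual` — for `Φ ∈ 𝒮(M_n(𝔸_K))`, `φ, φ' ∈ L²(X)`, an automorphic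
  `μ`, a Haar `ν`, an additive Haar measure `λ` on `M_n(𝔸_K)`: **if** the truncated zeta integral
  equals its dual term for `Re s ≥ n² + n + 2`,
  `Z^{<1}(Φ, s, φ, φ') = λ(D_M)⁻¹ ∫_G Φ̂_λ(g⁻¹) |det g|^{s-n} 𝟙_{|det g|<1} ⟪φ', R(g) φ⟫ dν(g)`
  (i.e. the right-hand side of `gjZeta_restrict_compl_sub_dual_eq_integral_gjSingDefect` vanishes —
  GJ §12 for cusp forms, `n ≥ 2`), **then** `Z(Φ, ·, φ, φ')` converges absolutely for
  `Re s > n² + n + 2` and is represented there by the entire function `Z^{≥1} + λ(D_M)⁻¹ ∫ F'' ⟪φ', R φ⟫`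
  (`GodementJacquetGlobalHolomorphy`, `GodementJacquetDualTerm`);

The cases `n ≤ 1` of the named fact are settled (`GodementJacquet1972_gjZeta_meromorphic_zero` in
`GodementJacquetGlobalHolomorphy`; `GodementJacquet1972_gjZeta_meromorphic_one` in
`HeckeLFunctionMeromorphicContinuationProofs`, from `gjZeta_meromorphic_continuation_fin_one` of
`GodementJacquetRankOne`); for `n ≥ 2` it remains to prove the vanishing hypothesis of this theorem for
`φ, φ'` in a cuspidal automorphic representation (reduction to smoothed cusp forms:
`GodementJacquetZetaOperator`; the term `ξ = 0`: `GLnCuspFormsOrthogonalConstants`).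

## References

* R. Godement, H. Jacquet, *Zeta functions of simple algebras*, LNM 260 (1972), §12–13, Thm. 13.8
  [GodementJacquet1972].
* J. Tate, in Cassels–Fröhlich (eds.), *Algebraic Number Theory* (1967), Ch. XV, Thm. 4.4.1
  [CasselsFrohlichANT1967].
-/

noncomputable section

open MeasureTheory Measure Set Filter Topology IsDedekindDomain NumberField
open Literature.MeasureTheory.Group
open scoped ENNReal NNReal ComplexConjugate MatrixGroups

namespace Literature.NumberTheory.Automorphic

-- the quotient carries the tree's Borel σ-algebra, not Mathlib's quotient σ-algebra
attribute [-instance] Quotient.instMeasurableSpace QuotientGroup.measurableSpace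

section HigherRank

variable {n : ℕ} {K : Type} [Field K] [NumberField K]

attribute [local instance] adelicBorel borelSpace_adelic locallyCompactSpace_adelic
  secondCountableTopology_gl_adelic measurableSpaceQuotient borelSpaceQuotient glBorel borelSpace_glBorel
  isHaarMeasure_glForm smulInvariantMeasureQuotient isFiniteMeasureOnCompactsQuotient
  secondCountableTopology_adeleRing locallyCompactSpace_adeleRing'

/-- **The continuation for `n ≥ 2`, given the vanishing of the singular defect.** If for a Haar
measure `λ` on `M_n(𝔸_K)` (Borel) and all `Re s ≥ n² + n + 2` the truncated zeta integral equals the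
dual term, `Z^{<1}(Φ, s, φ, φ') = λ(D_M)⁻¹ ∫_G Φ̂_λ(g⁻¹)|det g|^{s-n} 𝟙_{|det g|<1} ⟪φ', R(g) φ⟫ dν`
(the conclusion of `gjZeta_restrict_compl_sub_dual_eq_integral_gjSingDefect` with vanishing right-hand
side, Godement–Jacquet (1972), §12 for cusp forms), then `Z(Φ, ·, φ, φ')` converges absolutely for
`Re s > n² + n + 2` and extends to the **entire** function `Z^{≥1} + λ(D_M)⁻¹ ∫ F'' ⟪φ', R φ⟫`
(both terms entire: `GodementJacquetGlobalHolomorphy`, `GodementJacquetDualTerm`).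
[cite: GodementJacquet1972, §13 (proof of Thm. 13.8)] -/
theorem gjZeta_entire_continuation_of_eq_dual
    (μ : Measure (AdelicGroupData.gl n K).automorphicQuotient) [(AdelicGroupData.gl n K).IsAutomorphicMeasure μ]
    {Φ : Matrix (Fin n) (Fin n) (AdeleRing (𝓞 K) K) → ℂ} (hΦ : Φ ∈ schwartzBruhatAdelicMatrix n K)
    (φ φ' : (AdelicGroupData.gl n K).L2 μ) (ν : Measure (AdelicGroupData.gl n K).Adelic) [ν.IsHaarMeasure]
    [MeasurableSpace (AdeleRing (𝓞 K) K)] [BorelSpace (AdeleRing (𝓞 K) K)]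
    [MeasurableSpace (Matrix (Fin n) (Fin n) (AdeleRing (𝓞 K) K))]
    [BorelSpace (Matrix (Fin n) (Fin n) (AdeleRing (𝓞 K) K))]
    (lam : Measure (Matrix (Fin n) (Fin n) (AdeleRing (𝓞 K) K))) [lam.IsAddHaarMeasure]
    (hvan : ∀ s : ℂ, (n : ℝ) * n + n + 2 ≤ s.re →
      gjZeta μ (ν.restrict (detAtLeastOne n K)ᶜ) Φ φ φ' s =
        ((lam (matrixFundamentalDomain n K)).toReal : ℂ)⁻¹ *
          ∫ g : GL (Fin n) (AdeleRing (𝓞 K) K),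
            gjDualF n K (adelicMatrixFourier n K lam Φ) ((n : ℂ) - s) g⁻¹ * glMatrixCoeff μ φ φ' g ∂ν) :
    ∃ x₀ : ℝ, (∀ s : ℂ, x₀ < s.re → Integrable (gjZetaIntegrand μ Φ φ φ' s) ν) ∧
      ∃ g : ℂ → ℂ, Differentiable ℂ g ∧ ∀ s : ℂ, x₀ < s.re → g s = gjZeta μ ν Φ φ φ' s := by
  have hΦc : Continuous fun x : GL (Fin n) (AdeleRing (𝓞 K) K) => Φ (x : Matrix (Fin n) (Fin n) (AdeleRing (𝓞 K) K)) :=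
    (continuous_of_mem_schwartzBruhatAdelicMatrix hΦ).comp Units.continuous_val
  set x₀ : ℝ := (n : ℝ) * n + n + 2 with hx₀
  have hmaj : ∀ σ : ℝ, x₀ ≤ σ → Integrable (fun x : GL (Fin n) (AdeleRing (𝓞 K) K) =>
      ‖Φ (x : Matrix (Fin n) (Fin n) (AdeleRing (𝓞 K) K))‖ * (adelicAbsDet n K x : ℝ) ^ σ)
      (ν : Measure (GL (Fin n) (AdeleRing (𝓞 K) K))) := fun σ hσ =>
    integrable_norm_mul_adelicAbsDet_rpow_of_mem_schwartzBruhat (ν : Measure (GL (Fin n) (AdeleRing (𝓞 K) K))) hΦ hσ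
  have hint : ∀ s : ℂ, x₀ < s.re → Integrable (gjZetaIntegrand μ Φ φ φ' s) ν := fun s hs =>
    integrable_gjZetaIntegrand_of_integrable_norm_mul_rpow
      (aestronglyMeasurable_gjZetaIntegrand hΦc φ φ' s _) (hmaj s.re hs.le)
  set L : ℂ := ((lam (matrixFundamentalDomain n K)).toReal : ℂ)⁻¹ with hL
  set gZ : ℂ → ℂ := gjZeta μ ((ν : Measure (GL (Fin n) (AdeleRing (𝓞 K) K))).restrict (detAtLeastOne n K)) Φ φ φ' with hgZ
  set gM : ℂ → ℂ := fun s => ∫ g : GL (Fin n) (AdeleRing (𝓞 K) K),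
    gjDualF n K (adelicMatrixFourier n K lam Φ) ((n : ℂ) - s) g⁻¹ * glMatrixCoeff μ φ φ' g ∂ν with hgM
  have hgZd : Differentiable ℂ gZ :=
    differentiable_gjZeta_restrict_detAtLeastOne hΦc φ φ' (x₀ := x₀) fun σ hσ => hmaj σ hσ.le
  have hgMd : Differentiable ℂ gM :=
    differentiable_integral_gjDualF_inv_mul_glMatrixCoeff μ (adelicMatrixFourier_mem_schwartzBruhatAdelicMatrix lam hΦ) φ φ' ν
  refine ⟨x₀, hint, fun s => gZ s + L * gM s, hgZd.add (hgMd.const_mul L), fun s hs => ?_⟩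
  rw [gjZeta_eq_restrict_add_restrict_compl (ν : Measure (GL (Fin n) (AdeleRing (𝓞 K) K))) (hint s hs)]
  change gZ s + L * gM s = _
  congr 1
  exact (hvan s hs.le).symm

end HigherRank

end Literature.NumberTheory.Automorphic
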